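/-
Copyright (c) 2026 the pub-hodgecm-mathlib formalisation cell (harness21).  Prover seat hodgecm-mathlib-K2Liu-p23 (g0), Track B «K2-LIT» ∕ hLiu418
#184♮ = `stmt-HodgeConjecture-24832`, Road Φ ∕ socket #41, organ G5-a (Φ7-2), face (β0), sub-organ (β0-1a) C-PART (LEAD F0P6-plan (g14) EMIT #1
2026-09-04T14:48:16Z «p23 (β0-1a) C-part `K2LiuUnipDeltaCornerUnfoldC`, over ★ A p860018 ∕ B p860079»; K2Liu-p02 (g7) bus 12:24:00Z «the ONE remaining by-value
letter of the (β0-1) chain is `σ_{χ,s}(w₀ z w₀⁻¹) = 1` for `z ∈ N_χ(𝔸)`»).  THEOREMS ONLY.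
-/
import Summits.HodgeConjecture.HodgeConjecture.Theorems.K2LiuMiddleInnerSectionUnfold   -- ★ FILE C p860139 `exists_corner_unfold` (+ ★ FILE A∕B, ★ α2d-1∕α2d-2, ★ D9)
import HarnessLib

/-!
# Crux `HLiu418`, Road Φ, face (β0-1a), C-PART: THE INDUCING CHARACTER IS TRIVIAL ON `w₀ N_χ(𝔸) w₀⁻¹` — the `hZ` ∕ `hφZ` letter of the (β0-1) chain —
# and the unfolding of the inner section of the middle cell FOR SIEGEL SECTIONS (★ FILE C with its one by-value binder discharged)

Cell `hodgecm-mathlib`, crux item hLiu418 = `stmt-HodgeConjecture-24832`; squad K2 ∕ K2Liu; prover K2Liu-p23 (g0).  THEOREMS ONLY (no `def`, no instance, no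
notation, no named-fact hypothesis, no `sorry`); lane `--supports stmt-HodgeConjecture-24832 --as helper`.

WHY.  ★ FILE C `K2LiuMiddleInnerSectionUnfold.exists_corner_unfold` unfolds `∫_{N_Δ(𝔸)} β₁(u) • φ(u y) dνN(u) = C • ∫_{𝔸_{L⁺}} φ(n₂(t) y) dμ(t)` for every continuous
`φ` invariant under LEFT multiplication by `N_χ(𝔸) = {z ∈ N_Δ(𝔸) : w₀ z w₀⁻¹ ∈ P_Δ}` (binder `hφZ`), and ★ `K2LiuMiddleInnerSectionBorelLaw.inner_law_of_unfold` reads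
the Borel law of the inner section off such an unfolding modulo the binder `hZ : ∀ z ∈ Z, w₀ z w₀⁻¹ ∈ P ∧ σ (w₀ z w₀⁻¹) = 1`.  For the inner section of the middle
cell, `φ = f(w₀ ·)` with `f ∈ I(s, χ)` a Siegel section (★ `IsSiegelDeltaSection`: `f(p h) = σ_{χ,s}(p) f(h)`, `σ_{χ,s} = siegelDeltaCharacter χ s =
χ(det_Δ ·)|det_Δ ·|^{s + n/2}`), both binders are the SAME statement: **`σ_{χ,s}(w₀ z w₀⁻¹) = 1` for `z ∈ N_χ(𝔸)`** — `w₀ z w₀⁻¹` is Siegel but (unlike `z`)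
NOT in `N_Δ(𝔸)`, so ★ D9 `siegelDeltaCharacter_eq_one_of_mem_unipDelta` does not apply; what is true is that its `Δ`-block `det_Δ` is a UNIPOTENT matrix.
THIS FILE proves it by frame algebra, for ANY involution `g` of the partner group (`w_g = ι(1, g)`, `G = reindex e g`, `G² = 1`; any `n`):
* §0 (matrices over a commutative ring): in the triangular frame `E₁ · blk · E₂` of ★ `DoubledUnitarySiegelParabolicAlgebra`, `w_g ↦ (1 0; G − 1, G)`
  (★ `frame_iotaGG_one`) and `u ∈ N_Δ(𝔸) ↦ (1 X; 0 1)` (★ `mem_unipDelta_iff_conj`), so the `Δ`-block of `w_g u w_g` is **`1 + X(G − 1)`**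
  (`toBlocks₁₁_frame_conj_unip`); and if `G² = 1`, `(1 − G) X (1 − G) = 0` then **`det(1 + X(G − 1)) = 1`** (`det_one_add_mul_sub_one_eq_one`: `(1 − G)² = 2(1 − G)`,
  so `1 + X(G − 1) = 1 − (½X(1 − G))·(1 − G)` and Sylvester's `det(1 − AB) = det(1 − BA)` (Mathlib `Matrix.det_one_sub_mul_comm`) gives `det(1 − ½(1 − G)X(1 − G)) = 1`).
* §1 (the doubled group `H(𝔸)`): `deltaBlock_iotaGG_one_conj_unip`; **`detDelta_iotaGG_one_conj_unip`** (`det_Δ(w_g u w_g) = 1` on the stabiliser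
  `w_g u w_g ∈ P_Δ`, whose frame form `(1 − G)X(1 − G) = 0` is ★ `isSiegelDelta_conj_unip_iff`); **`siegelDeltaCharacter_iotaGG_one_conj_unip`** (`σ_{χ,s} = 1` there);
  **`apply_iotaGG_one_mul_unip_mul`** (`f(w_g (u h)) = f(w_g h)` for a Siegel section `f`: the `hφZ` letter).
* §2 (the datum of #41: `n = 2`, `w₀ = ι(1, g₀ ⊗ 1)`, `g₀ = diag(1 − 2·![0,1]∘e)` of ★ α2b, the `⁻¹`-forms via ★ α2d-1 `reflStd_inv`): **`apply_reflStd_mul_unip_mul`** —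
  the `hφZ` binder of ★ FILE C for `φ := f(w₀ ·)` BYTE FOR BYTE; **`reflStd_conj_mem_and_siegelDeltaCharacter_eq_one`** — the `hZ` binder of ★ `inner_law_of_unfold`
  BYTE FOR BYTE with `Z := {z | z ∈ N_Δ(𝔸) ∧ (X_z)₁₁ = 0}` (the `z` produced by ★ `K2LiuCornerTorusAction.exists_corner_zero_torus_inv_conj_eq_mul`; membership via ★ α2d-2
  `stabilizer_reflStd_iff`), `P := {p | IsSiegelDelta p}`, `σ := siegelDeltaCharacter χ s`.
* §3 **`inner_section_unfold`** — ★ FILE C INSTANTIATED AT SIEGEL SECTIONS: `∃ n₂ C, C ≠ 0 ∧ C ≠ ∞ ∧ (corner clauses verbatim) ∧ ∀ Γ₀ hΓ₀ β₁ hβ₁ χ s f (hf : f ∈ I(s,χ))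
  (hfc : Continuous f), (∀ y, integrability transfer ∧ ∫ β₁(u) • f(w₀ (u y)) dνN(u) = C • ∫ f(w₀ (n₂ t y)) dμ(t)) ∧ ∀ F, (F = α3-2's inner section) → ∀ y,
  F y = C · ∫ f(w₀ · n₂ t · y) dμ(t)` — the last clause is the `hunfold` binder of ★ `inner_law_of_unfold` for ★ α3-2 `K2LiuConstantTermMiddleCellGL2`'s `F` ON THE NOSE.
References: [MoeglinWaldspurger1995] II.1.7 (constant terms along `w⁻¹Pw ∩ N`: the inner integral is a section of the Levi's induced representation); [KudlaRallis1994]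
§2 (2.10)–(2.12); [GelbartPiatetskishapiroRallis1987] Part A §§1–2 (the doubled group, `P`, `w`, the cells); [Tan1999] §1 (the inducing character `χ(det)|det|^{s+n/2}`).
HONEST LABEL.  Count-neutral helper: `HC_CM` is proved only modulo the 7 printed citations (2 remaining named inputs: hLiu418 = `stmt-HodgeConjecture-24832`,
h413 = `stmt-HodgeConjecture-24833`) until rung 0 closes.
-/

set_option autoImplicit false
set_option linter.dupNamespace false -- the mandated namespace repeats `HodgeConjecture.HodgeConjecture`

noncomputable section

open scoped Matrix ENNReal NNReal
open NumberField IsDedekindDomain MeasureTheory MeasureTheory.Measure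
open Literature.NumberTheory.Automorphic Literature.NumberTheory.Automorphic.UnitaryGroup Literature.NumberTheory.GaloisRepresentations
open Literature.NumberTheory.GelbartRogawski1991 Literature.NumberTheory.GelbartRogawski1991.GRConstruction
open Literature.NumberTheory.K2Lit.SiegelDoubled Literature.MeasureTheory.Group
open Literature.NumberTheory.GelbartRogawski1991.AdaptedBlocks
open UnitaryDualPair
open Summit.HodgeConjecture.HodgeConjecture.Cruxes.HLiu418.K2LiuSiegelBruhatMiddleCellDelta (frame_iotaGG_one isSiegelDelta_conj_unip_iff iotaGG_one_mul_self reindex_mul_self)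
open Summit.HodgeConjecture.HodgeConjecture.Cruxes.HLiu418.K2LiuSiegelMiddleCellSortedPattern (mul_self_of_coe_eq_signDiagonal pattern_std)
open Summit.HodgeConjecture.HodgeConjecture.Cruxes.HLiu418.K2LiuSiegelMiddleCellLeviCriterion (reflStd_inv)
open Summit.HodgeConjecture.HodgeConjecture.Cruxes.HLiu418.K2LiuConstantTermMiddleCellOrbits (stabilizer_reflStd_iff)
open Summit.HodgeConjecture.HodgeConjecture.Cruxes.HLiu418.K2LiuMiddleInnerSectionUnfold (exists_corner_unfold)

namespace Summit.HodgeConjecture.HodgeConjecture.Cruxes.HLiu418.K2LiuUnipDeltaCornerUnfoldC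

/-! ## §0 Frame algebra: the `Δ`-block of `W · n(X) · W`, `W = (1 0; G − 1, G)`, and its determinant on the stabiliser -/

section Frame

variable {R : Type*} [CommRing R] {m : Type*} [Fintype m] [DecidableEq m]

/-- **the `Δ`-block of `W · (1 X; 0 1) · W` for the frame `W = (1 0; G − 1, G)` of `w_g` is `1 + X (G − 1)`.** [cite: GelbartPiatetskishapiroRallis1987, Part A §1] -/
theorem toBlocks₁₁_frame_conj_unip (G X : Matrix m m R) :
    (Matrix.fromBlocks (1 : Matrix m m R) 0 (G - 1) G * Matrix.fromBlocks 1 X 0 1 * Matrix.fromBlocks 1 0 (G - 1) G).toBlocks₁₁ = 1 + X * (G - 1) := by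
  rw [Matrix.fromBlocks_multiply, Matrix.fromBlocks_multiply, Matrix.toBlocks_fromBlocks₁₁]
  simp only [Matrix.one_mul, Matrix.mul_one, Matrix.mul_zero, add_zero]

/-- **`det (1 + X (G − 1)) = 1` for an involution `G² = 1` with `(1 − G) X (1 − G) = 0`**: `(1 − G)² = 2 (1 − G)`, so `1 + X(G − 1) = 1 − (½ X (1 − G)) · (1 − G)`, and
Sylvester's identity `det(1 − AB) = det(1 − BA)` gives `det(1 − ½ (1 − G) X (1 − G)) = det 1`. [folklore] -/
theorem det_one_add_mul_sub_one_eq_one [Invertible (2 : R)] {G X : Matrix m m R} (hG : G * G = 1) (hX : (1 - G) * X * (1 - G) = 0) :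
    (1 + X * (G - 1)).det = 1 := by
  have h2 : (1 - G) * (1 - G) = (2 : R) • (1 - G) := by
    rw [Matrix.sub_mul, Matrix.mul_sub, Matrix.mul_sub, Matrix.one_mul, Matrix.one_mul, Matrix.mul_one, hG]
    module
  have hrew : 1 + X * (G - 1) = 1 - (⅟ (2 : R) • (X * (1 - G))) * (1 - G) := by
    rw [Matrix.smul_mul, Matrix.mul_assoc, h2, Matrix.mul_smul, smul_smul, invOf_mul_self, one_smul]
    simp only [Matrix.mul_sub, Matrix.mul_one]
    abel
  rw [hrew, Matrix.det_one_sub_mul_comm, Matrix.mul_smul, ← Matrix.mul_assoc, hX, smul_zero, sub_zero, Matrix.det_one]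

end Frame

/-! ## §1 `det_Δ (w_g · u · w_g) = 1` on the stabiliser, and the inducing character there -/

section Involution

variable (L : Type) [Field L] [NumberField L] [IsCMField L]
variable {N M n : ℕ} (e : Fin N × Fin M ≃ Fin n)
  (dV : Fin N → L) (hdV : ∀ i, IsCMField.complexConj L (dV i) = dV i)
  (dW : Fin M → L) (hdW : ∀ i, IsCMField.complexConj L (dW i) = dW i)

/-- **the `Δ`-block of `w_g · u · w_g`** (`u ∈ N_Δ(𝔸)` with corner `X_u = (blk u)₁₂`, `G = reindex e g`): `deltaBlock (w_g u w_g) = 1 + X_u (G − 1)` (★ `deltaBlock_eq_conj`, ★ `conj_blk_mul`,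
★ `frame_iotaGG_one`, ★ `mem_unipDelta_iff_conj`, §0). [cite: GelbartPiatetskishapiroRallis1987, Part A §1] [cite: MoeglinWaldspurger1995, II.1.7] -/
theorem deltaBlock_iotaGG_one_conj_unip (g : UnitaryGroup.adelicPair (Fp L) L (IsCMField.complexConj L) N M (Matrix.diagonal dV) (Matrix.diagonal dW))
    {u : HA L e dV hdV dW hdW} (hu : u ∈ unipDelta L e dV hdV dW hdW) :
    deltaBlock L e dV hdV dW hdW (iotaGG L e dV hdV dW hdW (1, g) * u * iotaGG L e dV hdV dW hdW (1, g)) =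
      1 + (blk L e dV hdV dW hdW u).toBlocks₁₂ *
        (Matrix.reindex e e ((g : GL (Fin N × Fin M) (AdeleRing (𝓞 L) L)) : Matrix (Fin N × Fin M) (Fin N × Fin M) (AdeleRing (𝓞 L) L)) - 1) := by
  rw [deltaBlock_eq_conj, conj_blk_mul, conj_blk_mul, frame_iotaGG_one, (mem_unipDelta_iff_conj L e dV hdV dW hdW u).1 hu, toBlocks₁₁_frame_conj_unip]

/-- **`det_Δ (w_g · u · w_g) = 1` ON THE STABILISER**: for an involution `g` (`g² = 1`) and `u ∈ N_Δ(𝔸)` with `w_g u w_g ∈ P_Δ(𝔸)` — in frame form `(1 − G) X_u (1 − G) = 0`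
(★ `isSiegelDelta_conj_unip_iff`) — the `Δ`-block `1 + X_u(G − 1)` is unipotent, `det_Δ = 1` (§0 `det_one_add_mul_sub_one_eq_one`).
[cite: MoeglinWaldspurger1995, II.1.7] [cite: GelbartPiatetskishapiroRallis1987, Part A §§1–2] -/
theorem detDelta_iotaGG_one_conj_unip {g : UnitaryGroup.adelicPair (Fp L) L (IsCMField.complexConj L) N M (Matrix.diagonal dV) (Matrix.diagonal dW)}
    (hg : g * g = 1) {u : HA L e dV hdV dW hdW} (hu : u ∈ unipDelta L e dV hdV dW hdW)
    (hS : IsSiegelDelta L e dV hdV dW hdW (iotaGG L e dV hdV dW hdW (1, g) * u * iotaGG L e dV hdV dW hdW (1, g))) :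
    detDelta L e dV hdV dW hdW (iotaGG L e dV hdV dW hdW (1, g) * u * iotaGG L e dV hdV dW hdW (1, g)) = 1 := by
  have hX := (isSiegelDelta_conj_unip_iff L e dV hdV dW hdW hg hu).1 hS
  unfold detDelta
  rw [deltaBlock_iotaGG_one_conj_unip L e dV hdV dW hdW g hu]
  exact det_one_add_mul_sub_one_eq_one (reindex_mul_self L e dV dW hg) hX

/-- **THE INDUCING CHARACTER IS TRIVIAL ON `w_g · N_g(𝔸) · w_g`**: `χ(det_Δ p)|det_Δ p|^{s+n/2} = 1` at `p = w_g u w_g` for `u` in the stabiliser (`det_Δ p = 1`).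
[cite: Tan1999, §1] [cite: MoeglinWaldspurger1995, II.1.7] -/
theorem siegelDeltaCharacter_iotaGG_one_conj_unip (χ : HeckeCharacter L) (s : ℂ)
    {g : UnitaryGroup.adelicPair (Fp L) L (IsCMField.complexConj L) N M (Matrix.diagonal dV) (Matrix.diagonal dW)} (hg : g * g = 1)
    {u : HA L e dV hdV dW hdW} (hu : u ∈ unipDelta L e dV hdV dW hdW)
    (hS : IsSiegelDelta L e dV hdV dW hdW (iotaGG L e dV hdV dW hdW (1, g) * u * iotaGG L e dV hdV dW hdW (1, g))) :
    siegelDeltaCharacter L e dV hdV dW hdW χ s (iotaGG L e dV hdV dW hdW (1, g) * u * iotaGG L e dV hdV dW hdW (1, g)) = 1 := by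
  have hd := detDelta_iotaGG_one_conj_unip L e dV hdV dW hdW hg hu hS
  have hunit : IsUnit (detDelta L e dV hdV dW hdW (iotaGG L e dV hdV dW hdW (1, g) * u * iotaGG L e dV hdV dW hdW (1, g))) := by
    rw [hd]; exact isUnit_one
  have h1 : hunit.unit = 1 := Units.ext (by rw [IsUnit.unit_spec, hd, Units.val_one])
  unfold siegelDeltaCharacter chiDet modDelta
  rw [dif_pos hunit, dif_pos hunit, h1, map_one, ← coe_ideleNorm, map_one, NNReal.coe_one, Real.sqrt_one, Units.val_one, Complex.ofReal_one,
    Complex.one_cpow, mul_one]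

variable {L e dV hdV dW hdW} in
/-- **THE `hφZ` LETTER**: a Siegel section read behind `w_g` is invariant under the stabiliser — `f(w_g · (u · h)) = f(w_g · h)` for `f ∈ I(s, χ)`, `g² = 1`, `u ∈ N_Δ(𝔸)`,
`w_g u w_g ∈ P_Δ(𝔸)` (`w_g (u h) = (w_g u w_g)(w_g h)` as `w_g² = 1`, ★ `iotaGG_one_mul_self`; then the section law and `siegelDeltaCharacter_iotaGG_one_conj_unip`).
[cite: MoeglinWaldspurger1995, II.1.7] [cite: KudlaRallis1994, §2 (2.10)–(2.12)] -/
theorem apply_iotaGG_one_mul_unip_mul {χ : HeckeCharacter L} {s : ℂ} {f : HA L e dV hdV dW hdW → ℂ} (hf : IsSiegelDeltaSection L e dV hdV dW hdW χ s f)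
    {g : UnitaryGroup.adelicPair (Fp L) L (IsCMField.complexConj L) N M (Matrix.diagonal dV) (Matrix.diagonal dW)} (hg : g * g = 1)
    {u : HA L e dV hdV dW hdW} (hu : u ∈ unipDelta L e dV hdV dW hdW)
    (hS : IsSiegelDelta L e dV hdV dW hdW (iotaGG L e dV hdV dW hdW (1, g) * u * iotaGG L e dV hdV dW hdW (1, g))) (h : HA L e dV hdV dW hdW) :
    f (iotaGG L e dV hdV dW hdW (1, g) * (u * h)) = f (iotaGG L e dV hdV dW hdW (1, g) * h) := by
  have hw := iotaGG_one_mul_self L e dV hdV dW hdW hg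
  have heq : iotaGG L e dV hdV dW hdW (1, g) * u * iotaGG L e dV hdV dW hdW (1, g) * (iotaGG L e dV hdV dW hdW (1, g) * h) =
      iotaGG L e dV hdV dW hdW (1, g) * (u * h) := by
    rw [mul_assoc (iotaGG L e dV hdV dW hdW (1, g) * u), ← mul_assoc (iotaGG L e dV hdV dW hdW (1, g)) (iotaGG L e dV hdV dW hdW (1, g)) h, hw, one_mul,
      mul_assoc]
  rw [← heq, hf _ hS, siegelDeltaCharacter_iotaGG_one_conj_unip L e dV hdV dW hdW χ s hg hu hS, one_mul]

end Involution

/-! ## §2 The datum of #41 (`n = 2`, `w₀ = ι(1, g₀ ⊗ 1)`): the `hφZ` binder of ★ FILE C and the `hZ` binder of ★ `inner_law_of_unfold` -/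

section Two

variable (L : Type) [Field L] [NumberField L] [IsCMField L]
variable {N M : ℕ} (e : Fin N × Fin M ≃ Fin 2)
  (dV : Fin N → L) (hdV : ∀ i, IsCMField.complexConj L (dV i) = dV i)
  (dW : Fin M → L) (hdW : ∀ i, IsCMField.complexConj L (dW i) = dW i)
variable {g₀ : UnitaryGroup.rationalPair (Fp L) L (IsCMField.complexConj L) N M (Matrix.diagonal dV) (Matrix.diagonal dW)}
  (hg₀ : ((g₀ : GL (Fin N × Fin M) L) : Matrix (Fin N × Fin M) (Fin N × Fin M) L) = Matrix.diagonal (fun k => 1 - 2 * (![0, 1] : Fin 2 → L) (e k)))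

include hg₀ in
/-- `(g₀ ⊗ 1)² = 1` for the sign involution `g₀ = diag(1 − 2·![0,1]∘e)` (★ α2b `mul_self_of_coe_eq_signDiagonal`). [cite: GelbartPiatetskishapiroRallis1987, Part A §1] -/
theorem rationalPairToAdelic_reflStd_mul_self :
    UnitaryGroup.rationalPairToAdelic (Fp L) L (IsCMField.complexConj L) N M (Matrix.diagonal dV) (Matrix.diagonal dW) g₀ *
      UnitaryGroup.rationalPairToAdelic (Fp L) L (IsCMField.complexConj L) N M (Matrix.diagonal dV) (Matrix.diagonal dW) g₀ = 1 := by
  rw [← map_mul, mul_self_of_coe_eq_signDiagonal L e dV dW (pattern_std L) hg₀, map_one]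

include hg₀ in
/-- **THE `hφZ` BINDER OF ★ FILE C `exists_corner_unfold` AT `φ := f(w₀ ·)`, DISCHARGED**: for a Siegel section `f ∈ I(s, χ)`, every `z ∈ N_Δ(𝔸)` with `w₀ z w₀⁻¹ ∈ P_Δ(𝔸)` and every `h`,
`f(w₀ · (z · h)) = f(w₀ · h)` (§1 with `w₀⁻¹ = w₀`, ★ α2d-1 `reflStd_inv`). [cite: MoeglinWaldspurger1995, II.1.7] [cite: KudlaRallis1994, §2 (2.10)–(2.12)] -/
theorem apply_reflStd_mul_unip_mul {χ : HeckeCharacter L} {s : ℂ} {f : HA L e dV hdV dW hdW → ℂ} (hf : IsSiegelDeltaSection L e dV hdV dW hdW χ s f) :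
    ∀ z : HA L e dV hdV dW hdW, z ∈ unipDelta L e dV hdV dW hdW →
      IsSiegelDelta L e dV hdV dW hdW
        (iotaGG L e dV hdV dW hdW (1, UnitaryGroup.rationalPairToAdelic (Fp L) L (IsCMField.complexConj L) N M (Matrix.diagonal dV) (Matrix.diagonal dW) g₀) * z *
          (iotaGG L e dV hdV dW hdW (1, UnitaryGroup.rationalPairToAdelic (Fp L) L (IsCMField.complexConj L) N M (Matrix.diagonal dV) (Matrix.diagonal dW) g₀))⁻¹) →
      ∀ h : HA L e dV hdV dW hdW,
        f (iotaGG L e dV hdV dW hdW (1, UnitaryGroup.rationalPairToAdelic (Fp L) L (IsCMField.complexConj L) N M (Matrix.diagonal dV) (Matrix.diagonal dW) g₀) * (z * h)) =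
          f (iotaGG L e dV hdV dW hdW (1, UnitaryGroup.rationalPairToAdelic (Fp L) L (IsCMField.complexConj L) N M (Matrix.diagonal dV) (Matrix.diagonal dW) g₀) * h) := by
  intro z hz hS h
  rw [reflStd_inv L e dV hdV dW hdW hg₀] at hS
  exact apply_iotaGG_one_mul_unip_mul hf (rationalPairToAdelic_reflStd_mul_self L e dV dW hg₀) hz hS h

variable (Λ : GL (Fin 2) (AdeleRing (𝓞 L) L) →* HA L e dV hdV dW hdW)
  (hΛ : ∀ g : GL (Fin 2) (AdeleRing (𝓞 L) L), blk L e dV hdV dW hdW (Λ g) =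
    cayR (AdeleRing (𝓞 L) L) (Fin 2) * Matrix.fromBlocks (g : Matrix (Fin 2) (Fin 2) (AdeleRing (𝓞 L) L)) 0 0
      (((gramR L e dV hdV dW hdW).map ((algebraMap L (AdeleRing (𝓞 L) L)).comp (algebraMap (Fp L) L)))⁻¹ *
        (((g⁻¹ : GL (Fin 2) (AdeleRing (𝓞 L) L)) : Matrix (Fin 2) (Fin 2) (AdeleRing (𝓞 L) L)).map
          (conjAdele (Fp L) L (IsCMField.complexConj L)))ᵀ *
        (gramR L e dV hdV dW hdW).map ((algebraMap L (AdeleRing (𝓞 L) L)).comp (algebraMap (Fp L) L))) *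
      cayRinv (AdeleRing (𝓞 L) L) (Fin 2))

include hg₀ hΛ in
/-- **THE `hZ` BINDER OF ★ `K2LiuMiddleInnerSectionBorelLaw.inner_law_of_unfold`, DISCHARGED** for `Z := {z ∈ N_Δ(𝔸) : (X_z)₁₁ = 0}` (= `N_χ(𝔸)`, ★ α2d-2 `stabilizer_reflStd_iff`; the
`z` of ★ `K2LiuCornerTorusAction.exists_corner_zero_torus_inv_conj_eq_mul`), `P := P_Δ(𝔸)` and `σ := siegelDeltaCharacter χ s`: `w₀ z w₀⁻¹ ∈ P_Δ` and `σ(w₀ z w₀⁻¹) = 1`.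
[cite: MoeglinWaldspurger1995, II.1.7] [cite: KudlaRallis1994, §2 (2.10)–(2.12)] [cite: Tan1999, §1] -/
theorem reflStd_conj_mem_and_siegelDeltaCharacter_eq_one (χ : HeckeCharacter L) (s : ℂ) :
    ∀ z ∈ {z : HA L e dV hdV dW hdW | z ∈ unipDelta L e dV hdV dW hdW ∧ (blk L e dV hdV dW hdW z).toBlocks₁₂ 1 1 = 0},
      iotaGG L e dV hdV dW hdW (1, UnitaryGroup.rationalPairToAdelic (Fp L) L (IsCMField.complexConj L) N M (Matrix.diagonal dV) (Matrix.diagonal dW) g₀) * z *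
          (iotaGG L e dV hdV dW hdW (1, UnitaryGroup.rationalPairToAdelic (Fp L) L (IsCMField.complexConj L) N M (Matrix.diagonal dV) (Matrix.diagonal dW) g₀))⁻¹ ∈
        {p : HA L e dV hdV dW hdW | IsSiegelDelta L e dV hdV dW hdW p} ∧
      siegelDeltaCharacter L e dV hdV dW hdW χ s
        (iotaGG L e dV hdV dW hdW (1, UnitaryGroup.rationalPairToAdelic (Fp L) L (IsCMField.complexConj L) N M (Matrix.diagonal dV) (Matrix.diagonal dW) g₀) * z *
          (iotaGG L e dV hdV dW hdW (1, UnitaryGroup.rationalPairToAdelic (Fp L) L (IsCMField.complexConj L) N M (Matrix.diagonal dV) (Matrix.diagonal dW) g₀))⁻¹) = 1 := by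
  rintro z ⟨hz, hz11⟩
  have hS := (stabilizer_reflStd_iff hg₀ Λ hΛ hz).2 hz11
  refine ⟨hS, ?_⟩
  rw [reflStd_inv L e dV hdV dW hdW hg₀] at hS ⊢
  exact siegelDeltaCharacter_iotaGG_one_conj_unip L e dV hdV dW hdW χ s (rationalPairToAdelic_reflStd_mul_self L e dV dW hg₀) hz hS

/-! ## §3 ★ FILE C instantiated at Siegel sections: the inner section of the middle cell unfolds along the corner line, with NO by-value binder -/

include hg₀ hΛ in
/-- **(β0-1a) C-PART: THE INNER SECTION OF THE MIDDLE CELL UNFOLDS ALONG THE CORNER LINE FOR EVERY SIEGEL SECTION.**  For a Haar measure `νN` on `N_Δ(𝔸)` and an additive Haar measure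
`μ` on `𝔸_{L⁺}` there are the corner one-parameter subgroup `n₂ : 𝔸_{L⁺} → N_Δ(𝔸)` (continuous, additive, in `N_Δ(𝔸)`, frame coordinate `single 1 1 ((t⊗1)δ)`, rational on `L⁺`) and ONE
constant `C ∈ (0, ∞)` such that for every `Γ₀ = N_χ(L⁺)` (membership law of ★ α3-2), every `Γ₀`-covering weight `β₁`, every CONTINUOUS SIEGEL SECTION `f ∈ I(s, χ)`: (i) for every
`y`, `u ↦ β₁(u) • f(w₀ (u y))` is `νN`-integrable iff `t ↦ f(w₀ (n₂(t) y))` is `μ`-integrable, and `∫ β₁(u) • f(w₀ (u y)) dνN(u) = C • ∫ f(w₀ (n₂(t) y)) dμ(t)`; (ii) for α3-2's inner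
section `F(x) = ∫ β₁(u) • f(w₀ (u x)) dνN(u)`: **`F y = C · ∫ f(w₀ · n₂(t) · y) dμ(t)`** — the `hunfold` binder of ★ `inner_law_of_unfold`.  (★ FILE C `exists_corner_unfold` at
`φ := f(w₀ ·)`, its binder `hφZ` being §2 `apply_reflStd_mul_unip_mul`.) [cite: MoeglinWaldspurger1995, II.1.7] [cite: KudlaRallis1994, §2 (2.10)–(2.12)]
[cite: GelbartPiatetskishapiroRallis1987, Part A §2] -/
theorem inner_section_unfold (hdV0 : ∀ i, dV i ≠ 0) (hdW0 : ∀ i, dW i ≠ 0)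
    [MeasurableSpace (unipDelta L e dV hdV dW hdW)] [BorelSpace (unipDelta L e dV hdV dW hdW)]
    (νN : Measure (unipDelta L e dV hdV dW hdW)) [IsHaarMeasure νN]
    [MeasurableSpace (AdeleRing (𝓞 (Fp L)) (Fp L))] [BorelSpace (AdeleRing (𝓞 (Fp L)) (Fp L))]
    (μ : Measure (AdeleRing (𝓞 (Fp L)) (Fp L))) [μ.IsAddHaarMeasure] :
    ∃ (n₂ : AdeleRing (𝓞 (Fp L)) (Fp L) → HA L e dV hdV dW hdW) (C : ℝ≥0∞), C ≠ 0 ∧ C ≠ ∞ ∧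
      Continuous n₂ ∧ (∀ s t, n₂ (s + t) = n₂ s * n₂ t) ∧ (∀ t, n₂ t ∈ unipDelta L e dV hdV dW hdW) ∧
      (∀ t, (blk L e dV hdV dW hdW (n₂ t)).toBlocks₁₂ =
        Matrix.single (1 : Fin 2) (1 : Fin 2) (AdeleRing.baseChange (Fp L) L t * algebraMap L (AdeleRing (𝓞 L) L) (imagUnit L))) ∧
      (∀ t : Fp L, n₂ (algebraMap (Fp L) (AdeleRing (𝓞 (Fp L)) (Fp L)) t) ∈ ratH L e dV hdV dW hdW) ∧
      ∀ (Γ₀ : Subgroup (unipDelta L e dV hdV dW hdW))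
        (_ : ∀ u : unipDelta L e dV hdV dW hdW, u ∈ Γ₀ ↔ (u : HA L e dV hdV dW hdW) ∈ ratH L e dV hdV dW hdW ∧
          IsSiegelDelta L e dV hdV dW hdW
            (iotaGG L e dV hdV dW hdW (1, UnitaryGroup.rationalPairToAdelic (Fp L) L (IsCMField.complexConj L) N M (Matrix.diagonal dV) (Matrix.diagonal dW) g₀) *
              (u : HA L e dV hdV dW hdW) *
              (iotaGG L e dV hdV dW hdW (1, UnitaryGroup.rationalPairToAdelic (Fp L) L (IsCMField.complexConj L) N M (Matrix.diagonal dV) (Matrix.diagonal dW) g₀))⁻¹))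
        (β₁ : unipDelta L e dV hdV dW hdW → ℝ≥0∞) (_ : IsCoveringWeight Γ₀ β₁)
        (χ : HeckeCharacter L) (s : ℂ) (f : HA L e dV hdV dW hdW → ℂ) (_ : IsSiegelDeltaSection L e dV hdV dW hdW χ s f) (_ : Continuous f),
        (∀ y : HA L e dV hdV dW hdW,
          (Integrable (fun u : unipDelta L e dV hdV dW hdW => (β₁ u).toReal •
              f (iotaGG L e dV hdV dW hdW (1, UnitaryGroup.rationalPairToAdelic (Fp L) L (IsCMField.complexConj L) N M (Matrix.diagonal dV) (Matrix.diagonal dW) g₀) *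
                ((u : HA L e dV hdV dW hdW) * y))) νN ↔
            Integrable (fun t =>
              f (iotaGG L e dV hdV dW hdW (1, UnitaryGroup.rationalPairToAdelic (Fp L) L (IsCMField.complexConj L) N M (Matrix.diagonal dV) (Matrix.diagonal dW) g₀) *
                (n₂ t * y))) μ) ∧
          ∫ u, (β₁ u).toReal •
              f (iotaGG L e dV hdV dW hdW (1, UnitaryGroup.rationalPairToAdelic (Fp L) L (IsCMField.complexConj L) N M (Matrix.diagonal dV) (Matrix.diagonal dW) g₀) *
                ((u : HA L e dV hdV dW hdW) * y)) ∂νN =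
            C.toReal • ∫ t,
              f (iotaGG L e dV hdV dW hdW (1, UnitaryGroup.rationalPairToAdelic (Fp L) L (IsCMField.complexConj L) N M (Matrix.diagonal dV) (Matrix.diagonal dW) g₀) *
                (n₂ t * y)) ∂μ) ∧
        ∀ F : HA L e dV hdV dW hdW → ℂ,
          (∀ x, F x = ∫ u, (β₁ u).toReal •
            f (iotaGG L e dV hdV dW hdW (1, UnitaryGroup.rationalPairToAdelic (Fp L) L (IsCMField.complexConj L) N M (Matrix.diagonal dV) (Matrix.diagonal dW) g₀) *
              ((u : HA L e dV hdV dW hdW) * x)) ∂νN) →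
          ∀ y, F y = (C.toReal : ℂ) * ∫ t,
            f (iotaGG L e dV hdV dW hdW (1, UnitaryGroup.rationalPairToAdelic (Fp L) L (IsCMField.complexConj L) N M (Matrix.diagonal dV) (Matrix.diagonal dW) g₀) *
              n₂ t * y) ∂μ := by
  obtain ⟨n₂, C, hC0, hCtop, hn₂c, hn₂add, hn₂mem, hn₂X, hn₂rat, hunf⟩ := exists_corner_unfold L e dV hdV dW hdW hdV0 hdW0 hg₀ Λ hΛ νN μ
  refine ⟨n₂, C, hC0, hCtop, hn₂c, hn₂add, hn₂mem, hn₂X, hn₂rat, fun Γ₀ hΓ₀ β₁ hβ₁ χ s f hf hfc => ?_⟩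
  have hφc : Continuous fun x : HA L e dV hdV dW hdW =>
      f (iotaGG L e dV hdV dW hdW (1, UnitaryGroup.rationalPairToAdelic (Fp L) L (IsCMField.complexConj L) N M (Matrix.diagonal dV) (Matrix.diagonal dW) g₀) * x) :=
    hfc.comp (continuous_const.mul continuous_id)
  have key := fun y => hunf Γ₀ hΓ₀ β₁ hβ₁ (E := ℂ)
    (fun x => f (iotaGG L e dV hdV dW hdW (1, UnitaryGroup.rationalPairToAdelic (Fp L) L (IsCMField.complexConj L) N M (Matrix.diagonal dV) (Matrix.diagonal dW) g₀) * x))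
    hφc (apply_reflStd_mul_unip_mul L e dV hdV dW hdW hg₀ hf) y
  refine ⟨key, fun F hF y => ?_⟩
  rw [hF y, (key y).2, Complex.real_smul]
  congr 1
  refine integral_congr_ae (Filter.Eventually.of_forall fun t => ?_)
  simp only [mul_assoc]

end Two

end Summit.HodgeConjecture.HodgeConjecture.Cruxes.HLiu418.K2LiuUnipDeltaCornerUnfoldC

end
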